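import Literature.NumberTheory.Sieve.SelbergSieveGBoxBounds
import HarnessLib

/-!
# Extension sums on the Selberg box: `∑_{g ⊇ r} ∏_{p ∣ g, p ∤ r} a(p) ≤ ∏_p (1 + |ι| a(p))`

Source: J. Maynard, *Dense clusters of primes in subsets*, Compositio Math. 152 (2016) =
arXiv:1405.2593 [Maynard2016DenseClusters], proof of Proposition 9.4 pp. 25–26 (and the count in the
proof of Proposition 9.1 p. 19). In the `(k+1)`-dimensional change of variables of Prop. 9.4 the new
variables `y⁺_{(r,r₀)}` are sums over the vectors `g ⊇ r` of the box whose new prime factors lie in a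
prescribed set (P94-SPEC §1d′); bounding such sums by Euler products needs the following count on the
general box `SelbergBox.gBox` (each new prime `p` sits in one of the `|ι|` components):

* `eq_of_dvd_of_primeFactors_subset` — `r ∣ g`, `g ∈ box`, `primes(∏g) ⊆ primes(∏r)` ⇒ `g = r`;
* **`sum_ext_prod_le`** — for `r ∈ box`, a finite set of primes `S` disjoint from `∏ r`, and `a ≥ 0`:
  `∑_{g ∈ box, r ∣ g, primes(∏g) ⊆ primes(∏r) ∪ S} ∏_{p ∣ ∏g, p ∤ ∏r} a(p) ≤ ∏_{p ∈ S} (1 + |ι|·a(p))`;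
* **`sum_squarefree_ext_prod_le`** — the one-dimensional version (the extra coordinate `r₀ ∣ g₀`):
  over ANY finite set `T`, `∑_{g ∈ T : μ²(g)=1, r ∣ g, primes(g) ⊆ primes(r) ∪ S} ∏_{p ∣ g, p ∤ r} a(p)
  ≤ ∏_{p ∈ S}(1 + a(p))` (`g ↦ primes(g) ∖ primes(r)` is injective; `Finset.prod_one_add`).

## References
* J. Maynard, *Dense clusters of primes in subsets*, Compositio Math. 152 (2016), proof of Prop. 9.4
  pp. 25–26; proof of Prop. 9.1 p. 19 [Maynard2016DenseClusters].
-/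

noncomputable section

open Finset

namespace Literature.NumberTheory.Sieve.SelbergBox

variable {ι : Type*} [Fintype ι] [DecidableEq ι]

/-- On the box, `r ∣ g` coordinatewise and `primes(∏ g) ⊆ primes(∏ r)` force `g = r`.
[cite: Maynard2016DenseClusters, §7 p. 13 (square-free, pairwise coprime components)] -/
theorem eq_of_dvd_of_primeFactors_subset {N W : ι → ℕ} {r g : ι → ℕ} (hg : g ∈ gBox N W)
    (hrg : ∀ i, r i ∣ g i) (hpf : (∏ j, g j).primeFactors ⊆ (∏ j, r j).primeFactors) : g = r := by
  funext i
  by_contra hne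
  have hg1 : 1 ≤ g i := one_le_of_mem_gBox hg i
  obtain ⟨c, hc⟩ := hrg i
  have hc1 : c ≠ 1 := fun h1 => hne (by rw [hc, h1, mul_one])
  obtain ⟨q, hq, hqc⟩ := Nat.exists_prime_and_dvd hc1
  have hqgi : q ∣ g i := hqc.trans (Dvd.intro_left _ hc.symm)
  have hqg : q ∣ ∏ j, g j := hqgi.trans (Finset.dvd_prod_of_mem g (Finset.mem_univ i))
  have hg0 : (∏ j, g j) ≠ 0 := (squarefree_of_mem_gBox hg).ne_zero
  have hqmem : q ∈ (∏ j, r j).primeFactors := hpf (Nat.mem_primeFactors.2 ⟨hq, hqg, hg0⟩)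
  have hqr : q ∣ ∏ j, r j := Nat.dvd_of_mem_primeFactors hqmem
  obtain ⟨l, -, hql⟩ := (hq.prime.dvd_finsetProd_iff _).1 hqr
  by_cases hl : l = i
  · subst hl
    have hsq : Squarefree (g l) := squarefree_apply_of_mem_gBox hg l
    have : q * q ∣ g l := by rw [hc]; exact Nat.mul_dvd_mul hql hqc
    exact hq.not_isUnit (hsq q this)
  · have hqgl : q ∣ g l := hql.trans (hrg l)
    have hcop := coprime_apply_of_mem_gBox hg (Ne.symm hl)
    have h1 := Nat.dvd_gcd hqgi hqgl
    rw [hcop.gcd_eq_one] at h1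
    exact hq.one_lt.ne' (Nat.dvd_one.1 h1)

/-- **Extension sums on the box**: for `r ∈ box`, a finite set `S` of primes disjoint from the primes
of `∏ r`, and `a ≥ 0`,
`∑_{g ∈ box, r ∣ g, primes(∏ g) ⊆ primes(∏ r) ∪ S} ∏_{p ∈ primes(∏g) ∖ primes(∏r)} a(p) ≤ ∏_{p∈S}(1 + |ι| a(p))`
(peel one prime of `S` at a time: it is absent, or sits in one of the `|ι|` components).
[cite: Maynard2016DenseClusters, proof of Prop. 9.4 p. 25 (sums over the (k+1)-dimensional box); proof of Prop. 9.1 p. 19 («possible choices of which components … can be a multiple of p»)] -/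
theorem sum_ext_prod_le (N W : ι → ℕ) {r : ι → ℕ} (hr : r ∈ gBox N W) (a : ℕ → ℝ)
    (ha : ∀ p, 0 ≤ a p) :
    ∀ S : Finset ℕ, (∀ p ∈ S, p.Prime) → Disjoint S (∏ j, r j).primeFactors →
      ∑ g ∈ (gBox N W).filter (fun g => (∀ i, r i ∣ g i) ∧
          (∏ j, g j).primeFactors ⊆ (∏ j, r j).primeFactors ∪ S),
        ∏ p ∈ (∏ j, g j).primeFactors \ (∏ j, r j).primeFactors, a p ≤
      ∏ p ∈ S, (1 + Fintype.card ι * a p) := by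
  classical
  -- notation
  set box := gBox N W with hbox
  set Pr := (∏ j, r j).primeFactors with hPr
  have hterm0 : ∀ g : ι → ℕ, 0 ≤ ∏ p ∈ (∏ j, g j).primeFactors \ Pr, a p := fun g =>
    Finset.prod_nonneg fun p _ => ha p
  intro S
  induction S using Finset.induction_on with
  | empty =>
    intro _ _
    rw [Finset.prod_empty]
    have hsub : box.filter (fun g => (∀ i, r i ∣ g i) ∧ (∏ j, g j).primeFactors ⊆ Pr ∪ ∅) ⊆ {r} := by
      intro g hg
      obtain ⟨hgbox, hrg, hpf⟩ := Finset.mem_filter.1 hg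
      rw [Finset.union_empty] at hpf
      exact Finset.mem_singleton.2 (eq_of_dvd_of_primeFactors_subset hgbox hrg hpf)
    refine (Finset.sum_le_sum_of_subset_of_nonneg hsub fun g _ _ => hterm0 g).trans ?_
    rw [Finset.sum_singleton, Finset.sdiff_self, Finset.prod_empty]
  | insert p S hpS ih =>
    intro hprime hdisj
    have hp : p.Prime := hprime p (Finset.mem_insert_self p S)
    have hSprime : ∀ q ∈ S, q.Prime := fun q hq => hprime q (Finset.mem_insert_of_mem hq)
    have hdisjS : Disjoint S Pr := Finset.disjoint_of_subset_left (Finset.subset_insert p S) hdisj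
    have hpPr : p ∉ Pr := Finset.disjoint_left.1 hdisj (Finset.mem_insert_self p S)
    have hpr : ∀ i, ¬ p ∣ r i := fun i h => hpPr (Nat.mem_primeFactors.2
      ⟨hp, h.trans (Finset.dvd_prod_of_mem r (Finset.mem_univ i)),
        (squarefree_of_mem_gBox hr).ne_zero⟩)
    have IH := ih hSprime hdisjS
    set F := box.filter (fun g => (∀ i, r i ∣ g i) ∧
      (∏ j, g j).primeFactors ⊆ Pr ∪ insert p S) with hF
    set F' := box.filter (fun g => (∀ i, r i ∣ g i) ∧ (∏ j, g j).primeFactors ⊆ Pr ∪ S) with hF'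
    set t : (ι → ℕ) → ℝ := fun g => ∏ q ∈ (∏ j, g j).primeFactors \ Pr, a q with ht
    have hIH0 : 0 ≤ ∑ g ∈ F', t g := Finset.sum_nonneg fun g _ => hterm0 g
    -- Part A: the `g` with `p ∤ ∏ g` lie in `F'`.
    have hA : ∑ g ∈ F.filter (fun g => ¬ p ∣ ∏ j, g j), t g ≤ ∑ g ∈ F', t g := by
      refine Finset.sum_le_sum_of_subset_of_nonneg (fun g hg => ?_) fun g _ _ => hterm0 g
      obtain ⟨hgF, hpg⟩ := Finset.mem_filter.1 hg
      obtain ⟨hgbox, hrg, hpf⟩ := Finset.mem_filter.1 hgF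
      refine Finset.mem_filter.2 ⟨hgbox, hrg, fun q hq => ?_⟩
      have hq' := hpf hq
      rcases Finset.mem_union.1 hq' with h | h
      · exact Finset.mem_union.2 (Or.inl h)
      · rcases Finset.mem_insert.1 h with h | h
        · exact absurd (h ▸ Nat.dvd_of_mem_primeFactors hq) hpg
        · exact Finset.mem_union.2 (Or.inr h)
    -- Part B: the `g` with `p ∣ ∏ g`, split by the component `b` with `p ∣ g_b`.
    have hB1 : ∑ g ∈ F.filter (fun g => p ∣ ∏ j, g j), t g ≤
        ∑ b, ∑ g ∈ F.filter (fun g => p ∣ g b), t g := by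
      have hb : ∀ b, ∑ g ∈ F.filter (fun g => p ∣ g b), t g =
          ∑ g ∈ F, if p ∣ g b then t g else 0 := fun b => Finset.sum_filter _ _
      simp_rw [hb]
      rw [Finset.sum_comm, Finset.sum_filter]
      refine Finset.sum_le_sum fun g _ => ?_
      split_ifs with hpg
      · obtain ⟨b, -, hpb⟩ := (hp.prime.dvd_finsetProd_iff _).1 hpg
        calc t g = (if p ∣ g b then t g else 0) := by rw [if_pos hpb]
          _ ≤ ∑ b', (if p ∣ g b' then t g else 0) :=
              Finset.single_le_sum (f := fun b' => if p ∣ g b' then t g else 0)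
                (fun b' _ => by
                  show (0 : ℝ) ≤ if p ∣ g b' then t g else 0
                  split_ifs
                  · exact hterm0 g
                  · exact le_rfl)
                (Finset.mem_univ b)
      · exact Finset.sum_nonneg fun b' _ => by
          show (0 : ℝ) ≤ if p ∣ g b' then t g else 0
          split_ifs
          · exact hterm0 g
          · exact le_rfl
    have hB2 : ∀ b, ∑ g ∈ F.filter (fun g => p ∣ g b), t g ≤ a p * ∑ g' ∈ F', t g' := by
      intro b
      set φ : (ι → ℕ) → (ι → ℕ) := fun g => Function.update g b (g b / p) with hφ
      have hφdvd : ∀ g : ι → ℕ, p ∣ g b → ∀ j, φ g j ∣ g j := fun g hpb j => by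
        by_cases hj : j = b
        · subst hj; simp only [hφ, Function.update_self]; exact Nat.div_dvd_of_dvd hpb
        · simp only [hφ, Function.update_of_ne hj]; exact dvd_rfl
      -- pointwise: `t g = a p * t (φ g)`
      have hpt : ∀ g ∈ F.filter (fun g => p ∣ g b), t g = a p * t (φ g) := by
        intro g hg
        obtain ⟨hgF, hpb⟩ := Finset.mem_filter.1 hg
        obtain ⟨hgbox, -, -⟩ := Finset.mem_filter.1 hgF
        have hgsq : Squarefree (∏ j, g j) := squarefree_of_mem_gBox hgbox
        have hpg : p ∣ ∏ j, g j := hpb.trans (Finset.dvd_prod_of_mem g (Finset.mem_univ b))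
        have hprod : (∏ j, φ g j) = (∏ j, g j) / p := prod_update_div g b hpb
        have hpf' : (∏ j, φ g j).primeFactors = (∏ j, g j).primeFactors.erase p := by
          rw [hprod]; exact FGKMT2018.primeFactors_div_of_squarefree hgsq hp hpg
        have hset : (∏ j, g j).primeFactors \ Pr = insert p ((∏ j, φ g j).primeFactors \ Pr) := by
          rw [hpf']
          ext q
          simp only [Finset.mem_sdiff, Finset.mem_insert, Finset.mem_erase]
          constructor
          · rintro ⟨hq, hqPr⟩
            by_cases hqp : q = p
            · exact Or.inl hqp
            · exact Or.inr ⟨⟨hqp, hq⟩, hqPr⟩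
          · rintro (rfl | ⟨⟨-, hq⟩, hqPr⟩)
            · exact ⟨Nat.mem_primeFactors.2 ⟨hp, hpg, hgsq.ne_zero⟩, hpPr⟩
            · exact ⟨hq, hqPr⟩
        have hpnot : p ∉ (∏ j, φ g j).primeFactors \ Pr := by
          rw [hpf']; simp
        show ∏ q ∈ (∏ j, g j).primeFactors \ Pr, a q = a p * ∏ q ∈ (∏ j, φ g j).primeFactors \ Pr, a q
        rw [hset, Finset.prod_insert hpnot]
      have hinj : Set.InjOn φ ↑(F.filter (fun g => p ∣ g b)) := by
        intro g hg g₂ hg₂ hst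
        have hg' := (Finset.mem_filter.1 (Finset.mem_coe.1 hg)).2
        have hg₂' := (Finset.mem_filter.1 (Finset.mem_coe.1 hg₂)).2
        funext j
        by_cases hj : j = b
        · subst hj
          have h := congr_fun hst j
          simp only [hφ, Function.update_self] at h
          rw [← Nat.mul_div_cancel' hg', ← Nat.mul_div_cancel' hg₂', h]
        · have h := congr_fun hst j
          simp only [hφ, Function.update_of_ne hj] at h
          exact h
      have himg : (F.filter (fun g => p ∣ g b)).image φ ⊆ F' := by
        intro g' hg'
        obtain ⟨g, hg, rfl⟩ := Finset.mem_image.1 hg'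
        obtain ⟨hgF, hpb⟩ := Finset.mem_filter.1 hg
        obtain ⟨hgbox, hrg, hpf⟩ := Finset.mem_filter.1 hgF
        have hgsq : Squarefree (∏ j, g j) := squarefree_of_mem_gBox hgbox
        have hpg : p ∣ ∏ j, g j := hpb.trans (Finset.dvd_prod_of_mem g (Finset.mem_univ b))
        have hprod : (∏ j, φ g j) = (∏ j, g j) / p := prod_update_div g b hpb
        refine Finset.mem_filter.2 ⟨mem_gBox_of_dvd hgbox (hφdvd g hpb), fun j => ?_, ?_⟩
        · by_cases hj : j = b
          · subst hj
            simp only [hφ, Function.update_self]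
            have h1 : r j ∣ p * (g j / p) := by rw [Nat.mul_div_cancel' hpb]; exact hrg j
            exact (Nat.coprime_comm.1 ((Nat.Prime.coprime_iff_not_dvd hp).2 (hpr j))).dvd_of_dvd_mul_left h1
          · simp only [hφ, Function.update_of_ne hj]; exact hrg j
        · rw [hprod, FGKMT2018.primeFactors_div_of_squarefree hgsq hp hpg]
          intro q hq
          obtain ⟨hqp, hq'⟩ := Finset.mem_erase.1 hq
          rcases Finset.mem_union.1 (hpf hq') with h | h
          · exact Finset.mem_union.2 (Or.inl h)
          · rcases Finset.mem_insert.1 h with h | h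
            · exact absurd h hqp
            · exact Finset.mem_union.2 (Or.inr h)
      calc ∑ g ∈ F.filter (fun g => p ∣ g b), t g
          = ∑ g ∈ F.filter (fun g => p ∣ g b), a p * t (φ g) := Finset.sum_congr rfl hpt
        _ = a p * ∑ g ∈ F.filter (fun g => p ∣ g b), t (φ g) := by rw [Finset.mul_sum]
        _ = a p * ∑ g' ∈ (F.filter (fun g => p ∣ g b)).image φ, t g' := by
            rw [Finset.sum_image hinj]
        _ ≤ a p * ∑ g' ∈ F', t g' :=
            mul_le_mul_of_nonneg_left
              (Finset.sum_le_sum_of_subset_of_nonneg himg fun g' _ _ => hterm0 g') (ha p)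
    -- combine
    have hsplit : ∑ g ∈ F, t g =
        ∑ g ∈ F.filter (fun g => ¬ p ∣ ∏ j, g j), t g + ∑ g ∈ F.filter (fun g => p ∣ ∏ j, g j), t g := by
      rw [← Finset.sum_filter_add_sum_filter_not F (fun g => p ∣ ∏ j, g j), add_comm]
    have hcard : ∑ _b : ι, a p * ∑ g' ∈ F', t g' = Fintype.card ι * (a p * ∑ g' ∈ F', t g') := by
      rw [Finset.sum_const, Finset.card_univ, nsmul_eq_mul]
    calc ∑ g ∈ F, t g
        = ∑ g ∈ F.filter (fun g => ¬ p ∣ ∏ j, g j), t g +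
            ∑ g ∈ F.filter (fun g => p ∣ ∏ j, g j), t g := hsplit
      _ ≤ ∑ g ∈ F', t g + ∑ b, ∑ g ∈ F.filter (fun g => p ∣ g b), t g := add_le_add hA hB1
      _ ≤ ∑ g ∈ F', t g + ∑ _b : ι, a p * ∑ g' ∈ F', t g' :=
          add_le_add le_rfl (Finset.sum_le_sum fun b _ => hB2 b)
      _ = (1 + Fintype.card ι * a p) * ∑ g' ∈ F', t g' := by rw [hcard]; ring
      _ ≤ (1 + Fintype.card ι * a p) * ∏ q ∈ S, (1 + Fintype.card ι * a q) :=
          mul_le_mul_of_nonneg_left IH (by have := ha p; positivity)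
      _ = ∏ q ∈ insert p S, (1 + Fintype.card ι * a q) :=
          (Finset.prod_insert (f := fun q => 1 + (Fintype.card ι : ℝ) * a q) hpS).symm

omit [Fintype ι] [DecidableEq ι] in
/-- **One-dimensional extension sums**: for any `r`, a finite set `S` and `a ≥ 0`, over any finite `T`,
`∑_{g ∈ T : μ²(g) = 1, r ∣ g, primes(g) ⊆ primes(r) ∪ S} ∏_{p ∈ primes(g) ∖ primes(r)} a(p) ≤ ∏_{p∈S}(1 + a(p))`.
[cite: Maynard2016DenseClusters, proof of Prop. 9.4 pp. 25–26 (the sum over the extra coordinate r₀)] -/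
theorem sum_squarefree_ext_prod_le (r : ℕ) (S T : Finset ℕ) (a : ℕ → ℝ)
    (ha : ∀ p, 0 ≤ a p) :
    ∑ g ∈ T.filter (fun g => Squarefree g ∧ r ∣ g ∧ g.primeFactors ⊆ r.primeFactors ∪ S),
      ∏ p ∈ g.primeFactors \ r.primeFactors, a p ≤ ∏ p ∈ S, (1 + a p) := by
  classical
  set T' := T.filter (fun g => Squarefree g ∧ r ∣ g ∧ g.primeFactors ⊆ r.primeFactors ∪ S) with hT'
  set ψ : ℕ → Finset ℕ := fun g => g.primeFactors \ r.primeFactors with hψ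
  have hinj : Set.InjOn ψ ↑T' := by
    intro g₁ hg₁ g₂ hg₂ h
    obtain ⟨-, hsq₁, hr₁, -⟩ := Finset.mem_filter.1 (Finset.mem_coe.1 hg₁)
    obtain ⟨-, hsq₂, hr₂, -⟩ := Finset.mem_filter.1 (Finset.mem_coe.1 hg₂)
    have hsub : ∀ {g : ℕ}, Squarefree g → r ∣ g → r.primeFactors ⊆ g.primeFactors :=
      fun {g} hsq hrg => Nat.primeFactors_mono hrg hsq.ne_zero
    have hpf : g₁.primeFactors = g₂.primeFactors := by
      rw [← Finset.union_sdiff_of_subset (hsub hsq₁ hr₁), ← Finset.union_sdiff_of_subset (hsub hsq₂ hr₂)]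
      exact congrArg _ h
    rw [← Nat.prod_primeFactors_of_squarefree hsq₁, ← Nat.prod_primeFactors_of_squarefree hsq₂, hpf]
  have himg : T'.image ψ ⊆ S.powerset := by
    intro A hA
    obtain ⟨g, hg, rfl⟩ := Finset.mem_image.1 hA
    obtain ⟨-, -, -, hpf⟩ := Finset.mem_filter.1 hg
    rw [Finset.mem_powerset]
    intro p hp
    obtain ⟨hpg, hpr⟩ := Finset.mem_sdiff.1 hp
    rcases Finset.mem_union.1 (hpf hpg) with h | h
    · exact absurd h hpr
    · exact h
  calc ∑ g ∈ T', ∏ p ∈ g.primeFactors \ r.primeFactors, a p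
      = ∑ g ∈ T', ∏ p ∈ ψ g, a p := rfl
    _ = ∑ A ∈ T'.image ψ, ∏ p ∈ A, a p := (Finset.sum_image (f := fun A => ∏ p ∈ A, a p) hinj).symm
    _ ≤ ∑ A ∈ S.powerset, ∏ p ∈ A, a p :=
        Finset.sum_le_sum_of_subset_of_nonneg himg fun A _ _ => Finset.prod_nonneg fun p _ => ha p
    _ = ∏ p ∈ S, (1 + a p) := (Finset.prod_one_add S).symm

end Literature.NumberTheory.Sieve.SelbergBox
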